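import Mathlib.Algebra.BigOperators.Ring.Finset
import Mathlib.Algebra.Order.BigOperators.Group.Finset
import Mathlib.Data.Real.Basic
import Mathlib.Tactic
import HarnessLib

/-!
# TP₂ Toeplitz kernels are closed under composition (Lemma C of THEOREM MT: log-concavity of a
# convolution)

Support file for the Sahi / Conjecture-P programme of route `PercNearOneGluingNoHeavy`
(`--supports stmt-CriticalPhenomena-4575`, prover prim-l12-p5 gen 30; proof note
`prim-l12-p5/MULTITYPE-PROOF-g30.md`, Lemma C / §3.5 step (δ)).  No definitions, no named facts,
no sorries.

Lemma C of THEOREM MT needs: if `(β_m)` is a non-negative log-concave sequence without internal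
zeros then `γ_c = ∑_m β_m/(c-m)!` is log-concave (Menon 1969 / Karlin: PF₂ ∗ PF₂ ⊆ PF₂).  The clean
form is matrix-theoretic: a sequence `A : ℤ → ℝ` is PF₂ iff its Toeplitz kernel `(r,s) ↦ A(r-s)` is
TP₂, i.e. `A(r₁-s₂)A(r₂-s₁) ≤ A(r₁-s₁)A(r₂-s₂)` for `r₁ ≤ r₂`, `s₁ ≤ s₂`; and the composition
`(r,s) ↦ ∑_{m ∈ M} A(r-m)B(m-s)` of two TP₂ Toeplitz kernels over any finite index set `M` is again
TP₂, by the `2 × 2` Binet–Cauchy identity (each product of minors is `≥ 0`).  With `M ⊇ [s, r]` and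
`A, B` vanishing on the negatives these sums are the convolution `(A ∗ B)(r-s)`.

* `binet_cauchy_two` : `2·[(∑xy)(∑x'y') − (∑xy')(∑x'y)] = ∑∑ (x₁x'₂ − x₂x'₁)(y₁y'₂ − y₂y'₁)`;
* `tp2_toeplitz_comp` : TP₂ of the composed kernel;
* `logConcave_toeplitz_comp` : the consecutive `2 × 2` minor, i.e. log-concavity
  `C(c-1)C(c+1) ≤ C(c)²` of `C(n) = ∑_{m∈M} A(n-m)B(m)` written with a common index set;
* `allMinors_of_adjacent`, `toeplitz_tp2_extend` : the bridge from the adjacent-minor form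
  `a_i a_{j+1} ≤ a_{i+1} a_j` (`i ≤ j`) of a non-negative sequence on `ℕ` (as in
  `CPMonotone.esymm_tp2`) to the `ℤ`-Toeplitz hypothesis of `tp2_toeplitz_comp`.

(Compare `ToeplitzTP2`/`ChainTP2` of gen 25, which treat POSITIVE log-concave `φ : ℕ → ℝ` along a
chain; here no sign assumption is needed and the kernels live on `ℤ`.)
-/

namespace Summit.CriticalPhenomena.PercolationContinuityZ3.Theorems

namespace PFTwoConvolution

open Finset

/-- **Binet–Cauchy for `2 × 2` minors, symmetrised form**: for real functions `x, x', y, y'` on a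
finite set `M`,
`2·((∑ x y)(∑ x' y') − (∑ x y')(∑ x' y)) = ∑_{m₁} ∑_{m₂} (x m₁ x' m₂ − x m₂ x' m₁)(y m₁ y' m₂ − y m₂ y' m₁)`. -/
theorem binet_cauchy_two {ι : Type*} (M : Finset ι) (x x' y y' : ι → ℝ) :
    2 * ((∑ m ∈ M, x m * y m) * (∑ m ∈ M, x' m * y' m) -
        (∑ m ∈ M, x m * y' m) * (∑ m ∈ M, x' m * y m)) =
      ∑ m₁ ∈ M, ∑ m₂ ∈ M, (x m₁ * x' m₂ - x m₂ * x' m₁) * (y m₁ * y' m₂ - y m₂ * y' m₁) := by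
  have h1 : (∑ m ∈ M, x m * y m) * (∑ m ∈ M, x' m * y' m) =
      ∑ m₁ ∈ M, ∑ m₂ ∈ M, x m₁ * y m₁ * (x' m₂ * y' m₂) := by
    rw [sum_mul_sum]
  have h2 : (∑ m ∈ M, x m * y' m) * (∑ m ∈ M, x' m * y m) =
      ∑ m₁ ∈ M, ∑ m₂ ∈ M, x m₁ * y' m₁ * (x' m₂ * y m₂) := by
    rw [sum_mul_sum]
  -- the symmetrised summand splits into four products; two of them are the other two with
  -- `m₁ ↔ m₂`, which `sum_comm` identifies
  have h3 : ∑ m₁ ∈ M, ∑ m₂ ∈ M, (x m₁ * x' m₂ - x m₂ * x' m₁) * (y m₁ * y' m₂ - y m₂ * y' m₁) =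
      ∑ m₁ ∈ M, ∑ m₂ ∈ M, (x m₁ * y m₁ * (x' m₂ * y' m₂) - x m₁ * y' m₁ * (x' m₂ * y m₂)) +
        ∑ m₁ ∈ M, ∑ m₂ ∈ M, (x m₂ * y m₂ * (x' m₁ * y' m₁) - x m₂ * y' m₂ * (x' m₁ * y m₁)) := by
    rw [← sum_add_distrib]
    refine sum_congr rfl fun m₁ _ => ?_
    rw [← sum_add_distrib]
    refine sum_congr rfl fun m₂ _ => ?_
    ring
  have h4 : ∑ m₁ ∈ M, ∑ m₂ ∈ M, (x m₂ * y m₂ * (x' m₁ * y' m₁) - x m₂ * y' m₂ * (x' m₁ * y m₁)) =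
      ∑ m₁ ∈ M, ∑ m₂ ∈ M, (x m₁ * y m₁ * (x' m₂ * y' m₂) - x m₁ * y' m₁ * (x' m₂ * y m₂)) := by
    rw [sum_comm]
  rw [h3, h4, h1, h2, ← sum_sub_distrib]
  have h5 : ∑ m₁ ∈ M, ∑ m₂ ∈ M, (x m₁ * y m₁ * (x' m₂ * y' m₂) - x m₁ * y' m₁ * (x' m₂ * y m₂)) =
      ∑ m₁ ∈ M, (∑ m₂ ∈ M, x m₁ * y m₁ * (x' m₂ * y' m₂) - ∑ m₂ ∈ M, x m₁ * y' m₁ * (x' m₂ * y m₂)) := by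
    refine sum_congr rfl fun m₁ _ => ?_
    rw [sum_sub_distrib]
  rw [h5]
  ring

/-- **Composition of TP₂ Toeplitz kernels is TP₂** (Karlin; the matrix form of Menon's theorem that
the convolution of two PF₂ sequences is PF₂).  If `A(r₁-s₂)A(r₂-s₁) ≤ A(r₁-s₁)A(r₂-s₂)` and likewise
for `B` whenever `r₁ ≤ r₂`, `s₁ ≤ s₂`, then the kernel `P(r,s) = ∑_{m∈M} A(r-m)B(m-s)` (any finite
`M ⊆ ℤ`) satisfies the same `2 × 2` inequalities.  No sign assumption on `A, B` is needed: in the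
Binet–Cauchy expansion the two minors of each summand have the same sign. -/
theorem tp2_toeplitz_comp (A B : ℤ → ℝ)
    (hA : ∀ r₁ r₂ s₁ s₂ : ℤ, r₁ ≤ r₂ → s₁ ≤ s₂ → A (r₁ - s₂) * A (r₂ - s₁) ≤ A (r₁ - s₁) * A (r₂ - s₂))
    (hB : ∀ r₁ r₂ s₁ s₂ : ℤ, r₁ ≤ r₂ → s₁ ≤ s₂ → B (r₁ - s₂) * B (r₂ - s₁) ≤ B (r₁ - s₁) * B (r₂ - s₂))
    (M : Finset ℤ) (r₁ r₂ s₁ s₂ : ℤ) (hr : r₁ ≤ r₂) (hs : s₁ ≤ s₂) :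
    (∑ m ∈ M, A (r₁ - m) * B (m - s₂)) * (∑ m ∈ M, A (r₂ - m) * B (m - s₁)) ≤
      (∑ m ∈ M, A (r₁ - m) * B (m - s₁)) * (∑ m ∈ M, A (r₂ - m) * B (m - s₂)) := by
  -- Binet–Cauchy with x m = A(r₁-m), x' m = A(r₂-m), y m = B(m-s₁), y' m = B(m-s₂)
  have key := binet_cauchy_two M (fun m => A (r₁ - m)) (fun m => A (r₂ - m))
    (fun m => B (m - s₁)) (fun m => B (m - s₂))
  have hnn : 0 ≤ ∑ m₁ ∈ M, ∑ m₂ ∈ M,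
      (A (r₁ - m₁) * A (r₂ - m₂) - A (r₁ - m₂) * A (r₂ - m₁)) *
        (B (m₁ - s₁) * B (m₂ - s₂) - B (m₂ - s₁) * B (m₁ - s₂)) := by
    refine sum_nonneg fun m₁ _ => sum_nonneg fun m₂ _ => ?_
    rcases le_total m₁ m₂ with h | h
    · -- both minors are ≥ 0
      have h1 : 0 ≤ A (r₁ - m₁) * A (r₂ - m₂) - A (r₁ - m₂) * A (r₂ - m₁) :=
        sub_nonneg.2 (hA r₁ r₂ m₁ m₂ hr h)
      have h2 : 0 ≤ B (m₁ - s₁) * B (m₂ - s₂) - B (m₂ - s₁) * B (m₁ - s₂) := by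
        have := hB m₁ m₂ s₁ s₂ h hs
        linarith
      exact mul_nonneg h1 h2
    · -- both minors are ≤ 0
      have h1 : A (r₁ - m₁) * A (r₂ - m₂) - A (r₁ - m₂) * A (r₂ - m₁) ≤ 0 := by
        have := hA r₁ r₂ m₂ m₁ hr h
        linarith
      have h2 : B (m₁ - s₁) * B (m₂ - s₂) - B (m₂ - s₁) * B (m₁ - s₂) ≤ 0 := by
        have := hB m₂ m₁ s₁ s₂ h hs
        linarith
      exact mul_nonneg_of_nonpos_of_nonpos h1 h2
  nlinarith [key, hnn]

/-- **Log-concavity of a convolution of PF₂ sequences** (the form used in Lemma C of THEOREM MT,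
MULTITYPE-PROOF-g30 §3.5 (δ): `γ_c = ∑_m β_m/(c−m)!` is log-concave when `β` is PF₂, since `1/n!`
is PF₂).  In kernel form with a common finite index set `M`:
`C(c-1)·C(c+1) ≤ C(c)·C(c)` for `C(n) := ∑_{m∈M} A(n-m)B(m)` — take `r₁ = c`, `r₂ = c+1`, `s₁ = 0`,
`s₂ = 1` in `tp2_toeplitz_comp` (note `B(m-1)` realises the shift). -/
theorem logConcave_toeplitz_comp (A B : ℤ → ℝ)
    (hA : ∀ r₁ r₂ s₁ s₂ : ℤ, r₁ ≤ r₂ → s₁ ≤ s₂ → A (r₁ - s₂) * A (r₂ - s₁) ≤ A (r₁ - s₁) * A (r₂ - s₂))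
    (hB : ∀ r₁ r₂ s₁ s₂ : ℤ, r₁ ≤ r₂ → s₁ ≤ s₂ → B (r₁ - s₂) * B (r₂ - s₁) ≤ B (r₁ - s₁) * B (r₂ - s₂))
    (M : Finset ℤ) (c : ℤ) :
    (∑ m ∈ M, A (c - m) * B (m - 1)) * (∑ m ∈ M, A (c + 1 - m) * B (m - 0)) ≤
      (∑ m ∈ M, A (c - m) * B (m - 0)) * (∑ m ∈ M, A (c + 1 - m) * B (m - 1)) :=
  tp2_toeplitz_comp A B hA hB M c (c + 1) 0 1 (by linarith) (by norm_num)

/-- **From adjacent to arbitrary `2 × 2` minors** (no sign or non-vanishing assumption): if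
`a_i a_{j+1} ≤ a_{i+1} a_j` for all `i ≤ j` (the form proved for elementary symmetric functions in
`CPMonotone.esymm_tp2`), then `a_u a_{u+d+e} ≤ a_{u+d} a_{u+e}` for all `u, d, e` — all `2 × 2`
minors of the Toeplitz kernel with non-negative indices. -/
theorem allMinors_of_adjacent (a : ℕ → ℝ)
    (hU : ∀ i j : ℕ, i ≤ j → a i * a (j + 1) ≤ a (i + 1) * a j) :
    ∀ d e u : ℕ, a u * a (u + d + e) ≤ a (u + d) * a (u + e) := by
  intro d
  induction d with
  | zero =>
    intro e u
    simp
  | succ d ih =>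
    intro e u
    cases e with
    | zero =>
      simp [mul_comm]
    | succ e' =>
      have h1 := hU u (u + d + e' + 1) (by omega)
      have h2 := ih e' (u + 1)
      have e1 : u + (d + 1) + (e' + 1) = u + d + e' + 1 + 1 := by ring
      have e2 : u + 1 + d + e' = u + d + e' + 1 := by ring
      have e3 : u + 1 + d = u + (d + 1) := by ring
      have e4 : u + 1 + e' = u + (e' + 1) := by ring
      rw [e2, e3, e4] at h2
      rw [e1]
      exact le_trans h1 h2

/-- **The zero extension of an adjacent-TP₂ non-negative sequence is a TP₂ Toeplitz kernel on `ℤ`**: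
with `A(n) = a(n)` for `n ≥ 0` and `A(n) = 0` for `n < 0`, `A(r₁-s₂)A(r₂-s₁) ≤ A(r₁-s₁)A(r₂-s₂)` for
`r₁ ≤ r₂`, `s₁ ≤ s₂` — the hypothesis of `tp2_toeplitz_comp`. -/
theorem toeplitz_tp2_extend (a : ℕ → ℝ) (ha : ∀ n, 0 ≤ a n)
    (hU : ∀ i j : ℕ, i ≤ j → a i * a (j + 1) ≤ a (i + 1) * a j)
    (r₁ r₂ s₁ s₂ : ℤ) (hr : r₁ ≤ r₂) (hs : s₁ ≤ s₂) :
    (if 0 ≤ r₁ - s₂ then a (r₁ - s₂).toNat else 0) * (if 0 ≤ r₂ - s₁ then a (r₂ - s₁).toNat else 0) ≤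
      (if 0 ≤ r₁ - s₁ then a (r₁ - s₁).toNat else 0) *
        (if 0 ≤ r₂ - s₂ then a (r₂ - s₂).toNat else 0) := by
  have hnn : ∀ n : ℤ, 0 ≤ (if 0 ≤ n then a n.toNat else 0) := fun n => by
    split_ifs <;> simp [ha]
  by_cases h : 0 ≤ r₁ - s₂
  · have h2 : 0 ≤ r₂ - s₁ := by linarith
    have h3 : 0 ≤ r₁ - s₁ := by linarith
    have h4 : 0 ≤ r₂ - s₂ := by linarith
    rw [if_pos h, if_pos h2, if_pos h3, if_pos h4]
    have key := allMinors_of_adjacent a hU (s₂ - s₁).toNat (r₂ - r₁).toNat (r₁ - s₂).toNat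
    have i1 : (r₁ - s₂).toNat + (s₂ - s₁).toNat + (r₂ - r₁).toNat = (r₂ - s₁).toNat := by omega
    have i2 : (r₁ - s₂).toNat + (s₂ - s₁).toNat = (r₁ - s₁).toNat := by omega
    have i3 : (r₁ - s₂).toNat + (r₂ - r₁).toNat = (r₂ - s₂).toNat := by omega
    rw [i1, i2, i3] at key
    exact key
  · rw [not_le] at h
    rw [if_neg (not_le.2 h), zero_mul]
    exact mul_nonneg (hnn _) (hnn _)

end PFTwoConvolution

end Summit.CriticalPhenomena.PercolationContinuityZ3.Theorems
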